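import Literature.MathematicalPhysics.QuantumFieldTheory.Balaban1983to89.Node00.WilsonActionSecondVariationLeftChart

/-!
# NODE 00 — THE SECOND VARIATION OF THE WILSON ACTION (5), VI: THE `ℓ²(bonds)` CURRENCY OF THE LETTERS — «each positively oriented bond lies on exactly `2(d−1)` positively
# oriented plaquettes», so `Σ_p (Σ_k‖X_{b_k}‖)² ≤ 8(d−1)·Σ_b‖X_b‖²`; hence `|Q_U(X)| ≤ 8(d−1)Σ_b‖X_b‖²`, `|Q_U(X) − Q_1(X)| ≤ 32(d−1)δ·Σ_b‖X_b‖²` (right chart) and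
# `|Q^L_U(Y) − Q_1(Y)| ≤ 64(d−1)δ·Σ_b‖Y_b‖²` (left chart, also SUPPORT-LOCAL) when the bond variables are within `δ` of `1`

Cell `pub-ymgap`, WIDTH SEAT `pub-ymgap-dag-n12-w2` generation 2 (HUMAN RULING D-0149 ∕ director-ym №197; DAG node N12 = [B15]; key K1⁷ `stmt-QuantumFields-20542`,
`--kind proof --supports …`; count-neutral).  Successor piece (S5) of the U2a package of record (generation 0: p583639 · p585069 · p586296 · p587195 · p589765 · p589772 · p592028),
the item «U2a's flat value + (b) + chart junction» that dag-n12-w4 g0's closing census (INBOX 2026-08-28 l.26037) lists under «WHAT REMAINS FOR `h17` AT THE RECORD … w2's»;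
INBOX CLAIM + INTENT-1 l.26254 (file 1 of 2; file 2 = `B16Ineq19NearFlatSlice`, the SU(2) slice edition).

PRINT.  [B16] = [Balaban1989LargeFieldII] p. 357: «we expand the expressions defining the quadratic form with respect to A₀, up to the first order in A₀ … The leading term in the
expansion is the quadratic form with the background field identically equal to 1»; (1.7) p. 358: «⟨H_{1,k}B′, Δ₁(ζ₀)H_{1,k}B′⟩ ≧ γ₀ Σ_{c⊂B^k(Λ₀)}|(∂^{L^{−k}}Q_kH_{1,k}B′)(c)|² − O(1)M²(L^kR_kε_k)²
Σ_{b∈Λ₀}|B′(b)|²» — an error term proportional to the `ℓ²` NORM of the coordinate vector; [B9] = [Balaban1985BackgroundPropagators] p. 392 (3.10): «Δ′ will be a bounded, small operator».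
The U2a letters (p587195 `abs_deriv_deriv_wilsonAction4_expChart_sub_flat_le`, p592028 `abs_deriv_deriv_wilsonAction4_leftChart_sub_flat_le_local`) bound the error by PLAQUETTE sums
`Σ_p δ_p·s_p²`, `s_p(X) = Σ_{k≤4}‖X_{b_k}‖` (operator norm (19)); every consumer pairs them against `Σ_b‖X_b‖²` — the `Cerr·‖X‖²` slot of the N12 chain's `h17`∕`hsm`
(`B15Prop1OneSidedIneq17Edition` :395∕:403).  The conversion is the incidence count of this file.

CONTENTS (theorems only; no `def`, no `instance`).  `Q_U(X) := deriv (deriv (t ↦ A(U·e^{tX}))) 0` (n07-e's right chart `Node00.expChart`), `Q^L_U(Y) := deriv (deriv (t ↦ A(e^{tY}·U))) 0`.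
* §1 (any torus `T^{(j)}`): ★ `sum_plaq_boundary_eq` — `Σ_p (g(b₁)+g(b₂)+g(b₃)+g(b₄)) = 2(d−1)·Σ_b g(b)` for every `g : bonds → ℝ` (the four bonds `b₁ = ⟨x,μ⟩, b₂ = ⟨x+e_μ,ν⟩, b₃ = ⟨x+e_ν,μ⟩,
  b₄ = ⟨x,ν⟩` of `p = ⟨x, μ<ν⟩`; translation invariance of site sums + `μ<ν` bookkeeping); `sum_plaq_boundary_sq_le` — `Σ_p (n(b₁)+n(b₂)+n(b₃)+n(b₄))² ≤ 8(d−1)·Σ_b n(b)²`.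
* §2 (any `SU(N)`): `abs_deriv_deriv_wilsonAction4_expChart_le_l2` (`|Q_U(X)| ≤ 8(d−1)·Σ_b‖X_b‖²`), ★ `abs_deriv_deriv_wilsonAction4_expChart_sub_flat_le_l2` (`|Q_U(X) − Q_1(X)| ≤
  32(d−1)δ·Σ_b‖X_b‖²` when `‖U_b − 1‖ ≤ δ` for all `b`), ★ `abs_deriv_deriv_wilsonAction4_leftChart_sub_flat_le_l2_local` (left chart, `64(d−1)δ`, the background `δ`-close to `1` only on the
  plaquettes meeting the support of `Y` — [B16] p.357's `A₀` small ON `Z`), `abs_deriv_deriv_wilsonAction4_leftChart_sub_flat_le_l2` (global).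

HONEST SCOPE.  Elementary combinatorics and operator-norm bookkeeping about the tree's own functional; bond-wise `‖U_b − 1‖ ≤ δ` is a HYPOTHESIS (no gauge fixing here), as in p587195;
nothing of Bałaban's estimates beyond these explicit inequalities; count-neutral; N12 NOT discharged (5∕27 unmoved); finite 𝕋⁴ at fixed ε, Bałaban AS PRINTED with locators; R4 closes the
conditional rung `BalabanLadder.UV` only — the Yang–Mills mass gap (Clay) is NOT proved by any of this; nothing continuum ∕ ℝ⁴ ∕ OS.  No `sorry`, no `def`, no `instance`.
CONSUMED BY NAME: p587195 `abs_deriv_deriv_wilsonAction4_expChart_le` ∕ `…_sub_flat_le`, p592028 `abs_deriv_deriv_wilsonAction4_leftChart_sub_flat_le_local`.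
-/

noncomputable section

namespace Literature.MathematicalPhysics.QuantumFieldTheory.Balaban1983to89.Node00

open T4AdjointCovarianceUnitary (lieSU expSU coe_expSU specialUnitaryAd)
open scoped Matrix.Norms.L2Operator

/-! ## §1  The incidence count: each positively oriented bond lies on exactly `2(d−1)` positively oriented plaquettes -/

section Incidence

variable {P : Params} {j : ℕ}

/-- `(x − e_μ) + e_μ = x` (re-proof of the folklore torus bookkeeping, cf. `B10StarCount.shift_unshift`). [folklore] -/
private theorem shift_unshift' (x : Site P j) (μ : Fin P.d) : (x.unshift μ).shift μ = x := by
  funext ν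
  by_cases h : ν = μ
  · subst h; simp [Site.shift, Site.unshift]
  · simp [Site.shift, Site.unshift, Function.update_of_ne h]

/-- `(x + e_μ) − e_μ = x`. [folklore] -/
private theorem unshift_shift' (x : Site P j) (μ : Fin P.d) : (x.shift μ).unshift μ = x := by
  funext ν
  by_cases h : ν = μ
  · subst h; simp [Site.shift, Site.unshift]
  · simp [Site.shift, Site.unshift, Function.update_of_ne h]

/-- Translation invariance of site sums on the torus: `Σ_x g(x + e_μ) = Σ_x g(x)`. [folklore] -/
private theorem sum_shift' {M : Type*} [AddCommMonoid M] (μ : Fin P.d) (g : Site P j → M) :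
    ∑ x : Site P j, g (x.shift μ) = ∑ x : Site P j, g x :=
  Equiv.sum_comp ⟨fun x => x.shift μ, fun x => x.unshift μ, fun x => unshift_shift' x μ, fun x => shift_unshift' x μ⟩ g

/-- A sum over the positively oriented bonds is a double sum over initial points and directions. [cite: Balaban1985Averaging, (5) p.18 (bookkeeping)] -/
private theorem sum_pbond' {M : Type*} [AddCommMonoid M] (g : PBond P j → M) :
    ∑ b : PBond P j, g b = ∑ x : Site P j, ∑ μ : Fin P.d, g ⟨x, μ⟩ := by
  rw [← Fintype.sum_prod_type (f := fun q : Site P j × Fin P.d => g ⟨q.1, q.2⟩)]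
  exact Fintype.sum_equiv ⟨fun b => (b.src, b.dir), fun q => ⟨q.1, q.2⟩, fun _ => rfl, fun _ => rfl⟩ _ _ (fun _ => rfl)

/-- Plaquette reindexing: a sum over the plaquettes `⟨x, μ<ν⟩` of `T^{(j)}` is the sum over ORDERED direction pairs of the site sums (re-proof of the private helper of
`B5AverageCurlStokesV1` ∕ `B16Ineq17FlatRouteConstants`). [cite: Balaban1985Averaging, (5) p.18 (bookkeeping)] -/
private theorem sum_plaq_eq' {M : Type*} [AddCommMonoid M] (f : Site P j → Fin P.d → Fin P.d → M) :
    ∑ p : Plaq P j, f p.src p.μ p.ν = ∑ μ : Fin P.d, ∑ ν : Fin P.d, if μ < ν then ∑ x : Site P j, f x μ ν else 0 := by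
  classical
  have hinj : Function.Injective (fun p : Plaq P j => (p.src, p.μ, p.ν)) := by
    rintro ⟨x, μ, ν, h⟩ ⟨x', μ', ν', h'⟩ hpq
    simp only [Prod.mk.injEq] at hpq
    obtain ⟨h1, h2, h3⟩ := hpq
    subst h1; subst h2; subst h3
    rfl
  have himg : (Finset.univ : Finset (Plaq P j)).image (fun p => (p.src, p.μ, p.ν))
      = Finset.univ.filter (fun t : Site P j × Fin P.d × Fin P.d => t.2.1 < t.2.2) := by
    ext t
    simp only [Finset.mem_image, Finset.mem_univ, true_and, Finset.mem_filter]
    constructor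
    · rintro ⟨p, rfl⟩
      exact p.hμν
    · intro ht
      exact ⟨⟨t.1, t.2.1, t.2.2, ht⟩, rfl⟩
  calc ∑ p : Plaq P j, f p.src p.μ p.ν
      = ∑ t ∈ (Finset.univ : Finset (Plaq P j)).image (fun p => (p.src, p.μ, p.ν)), f t.1 t.2.1 t.2.2 := by
        rw [Finset.sum_image fun p _ q _ h => hinj h]
    _ = ∑ t ∈ Finset.univ.filter (fun t : Site P j × Fin P.d × Fin P.d => t.2.1 < t.2.2), f t.1 t.2.1 t.2.2 := by rw [himg]
    _ = ∑ t : Site P j × Fin P.d × Fin P.d, if t.2.1 < t.2.2 then f t.1 t.2.1 t.2.2 else 0 := Finset.sum_filter _ _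
    _ = ∑ x : Site P j, ∑ μ : Fin P.d, ∑ ν : Fin P.d, if μ < ν then f x μ ν else 0 := by
        rw [Fintype.sum_prod_type]
        exact Finset.sum_congr rfl fun x _ => by rw [Fintype.sum_prod_type]
    _ = ∑ μ : Fin P.d, ∑ ν : Fin P.d, if μ < ν then ∑ x : Site P j, f x μ ν else 0 := by
        rw [Finset.sum_comm]
        refine Finset.sum_congr rfl fun μ _ => ?_
        rw [Finset.sum_comm]
        refine Finset.sum_congr rfl fun ν _ => ?_
        by_cases h : μ < ν
        · simp only [if_pos h]
        · simp only [if_neg h, Finset.sum_const_zero]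

/-- The direction bookkeeping: `Σ_{μ<ν} (G μ + G ν) = (d − 1)·Σ_μ G μ` (every direction is paired with the `d − 1` others exactly once). [folklore] -/
private theorem sum_lt_pairs_add (G : Fin P.d → ℝ) :
    ∑ μ : Fin P.d, ∑ ν : Fin P.d, (if μ < ν then G μ + G ν else 0) = ((P.d : ℝ) - 1) * ∑ μ : Fin P.d, G μ := by
  classical
  have hsplit : ∑ μ : Fin P.d, ∑ ν : Fin P.d, (if μ < ν then G μ + G ν else 0)
      = ∑ μ : Fin P.d, ∑ ν : Fin P.d, (if μ < ν then G μ else 0) + ∑ μ : Fin P.d, ∑ ν : Fin P.d, (if μ < ν then G ν else 0) := by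
    rw [← Finset.sum_add_distrib]
    refine Finset.sum_congr rfl fun μ _ => ?_
    rw [← Finset.sum_add_distrib]
    refine Finset.sum_congr rfl fun ν _ => ?_
    split_ifs <;> simp
  have hswap : ∑ μ : Fin P.d, ∑ ν : Fin P.d, (if μ < ν then G ν else 0) = ∑ μ : Fin P.d, ∑ ν : Fin P.d, (if ν < μ then G μ else 0) := by
    rw [Finset.sum_comm]
  rw [hsplit, hswap, ← Finset.sum_add_distrib, Finset.mul_sum]
  refine Finset.sum_congr rfl fun μ _ => ?_
  rw [← Finset.sum_add_distrib]
  have hpt : ∀ ν : Fin P.d, ((if μ < ν then G μ else 0) + if ν < μ then G μ else 0) = if ν ≠ μ then G μ else 0 := by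
    intro ν
    by_cases h1 : μ < ν
    · rw [if_pos h1, if_neg (lt_asymm h1), if_pos (ne_of_gt h1), add_zero]
    · by_cases h2 : ν < μ
      · rw [if_neg h1, if_pos h2, if_pos (ne_of_lt h2), zero_add]
      · have : ν = μ := le_antisymm (not_lt.mp h1) (not_lt.mp h2)
        rw [if_neg h1, if_neg h2, if_neg (fun h => h this), add_zero]
  simp only [hpt]
  rw [Finset.sum_ite, Finset.sum_const_zero, add_zero, Finset.sum_const, nsmul_eq_mul]
  congr 1
  rw [Finset.filter_ne' Finset.univ μ, Finset.card_erase_of_mem (Finset.mem_univ μ), Finset.card_univ, Fintype.card_fin,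
    Nat.cast_sub P.hd, Nat.cast_one]

/-- ★ **THE INCIDENCE COUNT**: for every real function `g` on the positively oriented bonds of `T^{(j)}`, summing `g` over the four boundary bonds `⟨x,μ⟩, ⟨x+e_μ,ν⟩, ⟨x+e_ν,μ⟩, ⟨x,ν⟩` of every
positively oriented plaquette `p = ⟨x, μ<ν⟩` counts each bond exactly `2(d−1)` times: `Σ_p (g b₁ + g b₂ + g b₃ + g b₄) = 2(d−1)·Σ_b g b` (a bond `⟨y,λ⟩` is `b₁` or `b₄` of the `d−1`
plaquettes at `y` in the planes `{λ, κ}`, `κ ≠ λ`, and `b₂` or `b₃` of the `d−1` plaquettes at `y − e_κ`). [cite: Balaban1985Averaging, (5) p.18; Balaban1985BackgroundPropagators, (3.10) p.392 (bookkeeping)] -/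
theorem sum_plaq_boundary_eq (g : PBond P j → ℝ) :
    ∑ p : Plaq P j, (g ⟨p.src, p.μ⟩ + g ⟨p.src.shift p.μ, p.ν⟩ + g ⟨p.src.shift p.ν, p.μ⟩ + g ⟨p.src, p.ν⟩)
      = 2 * ((P.d : ℝ) - 1) * ∑ b : PBond P j, g b := by
  rw [sum_plaq_eq' (fun x μ ν => g ⟨x, μ⟩ + g ⟨x.shift μ, ν⟩ + g ⟨x.shift ν, μ⟩ + g ⟨x, ν⟩)]
  have hx : ∀ μ ν : Fin P.d, ∑ x : Site P j, (g ⟨x, μ⟩ + g ⟨x.shift μ, ν⟩ + g ⟨x.shift ν, μ⟩ + g ⟨x, ν⟩)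
      = 2 * ((∑ x : Site P j, g ⟨x, μ⟩) + ∑ x : Site P j, g ⟨x, ν⟩) := by
    intro μ ν
    simp only [Finset.sum_add_distrib]
    rw [sum_shift' μ (fun x => g ⟨x, ν⟩), sum_shift' ν (fun x => g ⟨x, μ⟩)]
    ring
  simp only [hx]
  have h2 : ∀ μ ν : Fin P.d, (if μ < ν then 2 * ((∑ x : Site P j, g ⟨x, μ⟩) + ∑ x : Site P j, g ⟨x, ν⟩) else (0 : ℝ))
      = 2 * (if μ < ν then (∑ x : Site P j, g ⟨x, μ⟩) + ∑ x : Site P j, g ⟨x, ν⟩ else 0) := by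
    intro μ ν; split_ifs <;> simp
  simp only [h2, ← Finset.mul_sum]
  rw [sum_lt_pairs_add (fun μ => ∑ x : Site P j, g ⟨x, μ⟩), sum_pbond' g, Finset.sum_comm]
  ring

/-- Four letters: `(a + b + c + d)² ≤ 4(a² + b² + c² + d²)`. [folklore] -/
private theorem add_four_sq_le (a b c d : ℝ) : (a + b + c + d) ^ 2 ≤ 4 * (a ^ 2 + b ^ 2 + c ^ 2 + d ^ 2) := by
  nlinarith [sq_nonneg (a - b), sq_nonneg (a - c), sq_nonneg (a - d), sq_nonneg (b - c), sq_nonneg (b - d), sq_nonneg (c - d)]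

/-- **THE SQUARED LETTERS IN `ℓ²(bonds)`**: `Σ_p (n b₁ + n b₂ + n b₃ + n b₄)² ≤ 8(d−1)·Σ_b (n b)²` for every real bond function `n` (Cauchy–Schwarz on the four letters + the incidence count).
[cite: Balaban1989LargeFieldII, (1.7) p.358 («O(1)… Σ_{b∈Λ₀}|B′(b)|²»); Balaban1985BackgroundPropagators, (3.10) p.392] -/
theorem sum_plaq_boundary_sq_le (n : PBond P j → ℝ) :
    ∑ p : Plaq P j, (n ⟨p.src, p.μ⟩ + n ⟨p.src.shift p.μ, p.ν⟩ + n ⟨p.src.shift p.ν, p.μ⟩ + n ⟨p.src, p.ν⟩) ^ 2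
      ≤ 8 * ((P.d : ℝ) - 1) * ∑ b : PBond P j, n b ^ 2 := by
  calc ∑ p : Plaq P j, (n ⟨p.src, p.μ⟩ + n ⟨p.src.shift p.μ, p.ν⟩ + n ⟨p.src.shift p.ν, p.μ⟩ + n ⟨p.src, p.ν⟩) ^ 2
      ≤ ∑ p : Plaq P j, 4 * (n ⟨p.src, p.μ⟩ ^ 2 + n ⟨p.src.shift p.μ, p.ν⟩ ^ 2 + n ⟨p.src.shift p.ν, p.μ⟩ ^ 2 + n ⟨p.src, p.ν⟩ ^ 2) :=
        Finset.sum_le_sum fun p _ => add_four_sq_le _ _ _ _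
    _ = 4 * (2 * ((P.d : ℝ) - 1) * ∑ b : PBond P j, n b ^ 2) := by
        rw [← Finset.mul_sum, sum_plaq_boundary_eq (fun b => n b ^ 2)]
    _ = 8 * ((P.d : ℝ) - 1) * ∑ b : PBond P j, n b ^ 2 := by ring

end Incidence

/-! ## §2  The letters of the U2a files in `ℓ²(bonds)` currency (any `SU(N)`) -/

section L2Letters

variable {P : Params} {j : ℕ} {N : ℕ} [NeZero N]

/-- **`|Q_U(X)| ≤ 8(d−1)·Σ_b‖X_b‖²`** for EVERY background `U` — p587195's `abs_deriv_deriv_wilsonAction4_expChart_le` in `ℓ²(bonds)` currency («Δ(U) … a bounded operator», [B9] p.392).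
[cite: Balaban1985BackgroundPropagators, (3.10) p.392; Balaban1985Averaging, (20) p.21] -/
theorem abs_deriv_deriv_wilsonAction4_expChart_le_l2 (U : GaugeField P j (SU N)) (X : PBond P j → lieSU (Fin N)) :
    |deriv (deriv fun s : ℝ => wilsonAction4 (expChart U (s • X))) 0| ≤ 8 * ((P.d : ℝ) - 1) * ∑ b : PBond P j, ‖(X b : Matrix (Fin N) (Fin N) ℂ)‖ ^ 2 :=
  (abs_deriv_deriv_wilsonAction4_expChart_le U X).trans (sum_plaq_boundary_sq_le fun b => ‖(X b : Matrix (Fin N) (Fin N) ℂ)‖)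

/-- ★ **LETTER (b) IN `ℓ²(bonds)` CURRENCY (right chart)**: if `‖U_b − 1‖ ≤ δ` for every bond, then `|Q_U(X) − Q_1(X)| ≤ 32(d−1)δ·Σ_b‖X_b‖²` — [B16] (1.7)'s error term «O(1)·(…ε_k)²·Σ_b|B′(b)|²»
at the level of the bare action. [cite: Balaban1989LargeFieldII, p.357, (1.7) p.358; Balaban1985BackgroundPropagators, (3.10) p.392] -/
theorem abs_deriv_deriv_wilsonAction4_expChart_sub_flat_le_l2 (U : GaugeField P j (SU N)) (X : PBond P j → lieSU (Fin N)) {δ : ℝ}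
    (hδ : ∀ b : PBond P j, ‖(U b : Matrix (Fin N) (Fin N) ℂ) - 1‖ ≤ δ) :
    |deriv (deriv fun s : ℝ => wilsonAction4 (expChart U (s • X))) 0 - deriv (deriv fun s : ℝ => wilsonAction4 (expChart 1 (s • X))) 0|
      ≤ 32 * ((P.d : ℝ) - 1) * δ * ∑ b : PBond P j, ‖(X b : Matrix (Fin N) (Fin N) ℂ)‖ ^ 2 := by
  obtain ⟨b₀⟩ : Nonempty (PBond P j) := ⟨⟨default, ⟨0, P.hd⟩⟩⟩
  have hδ0 : 0 ≤ δ := (norm_nonneg _).trans (hδ b₀)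
  calc |deriv (deriv fun s : ℝ => wilsonAction4 (expChart U (s • X))) 0 - deriv (deriv fun s : ℝ => wilsonAction4 (expChart 1 (s • X))) 0|
      ≤ 4 * δ * ∑ p : Plaq P j, (‖(X ⟨p.src, p.μ⟩ : Matrix (Fin N) (Fin N) ℂ)‖ + ‖(X ⟨p.src.shift p.μ, p.ν⟩ : Matrix (Fin N) (Fin N) ℂ)‖
          + ‖(X ⟨p.src.shift p.ν, p.μ⟩ : Matrix (Fin N) (Fin N) ℂ)‖ + ‖(X ⟨p.src, p.ν⟩ : Matrix (Fin N) (Fin N) ℂ)‖) ^ 2 :=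
        abs_deriv_deriv_wilsonAction4_expChart_sub_flat_le U X hδ
    _ ≤ 4 * δ * (8 * ((P.d : ℝ) - 1) * ∑ b : PBond P j, ‖(X b : Matrix (Fin N) (Fin N) ℂ)‖ ^ 2) :=
        mul_le_mul_of_nonneg_left (sum_plaq_boundary_sq_le fun b => ‖(X b : Matrix (Fin N) (Fin N) ℂ)‖) (by positivity)
    _ = 32 * ((P.d : ℝ) - 1) * δ * ∑ b : PBond P j, ‖(X b : Matrix (Fin N) (Fin N) ℂ)‖ ^ 2 := by ring

/-- ★ **LETTER (b) IN `ℓ²(bonds)` CURRENCY, SUPPORT-LOCAL, LEFT CHART**: if `Y` vanishes off a bond set `B` and the four bond variables of every plaquette meeting `B` are within `δ ≥ 0` of `1`,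
then `|Q^L_U(Y) − Q_1(Y)| ≤ 64(d−1)δ·Σ_b‖Y_b‖²` (p592028's per-plaquette budget with `δ_p := δ` on the plaquettes meeting `B` and `δ_p := 2` elsewhere, where `Y`'s letters vanish;
[B16] p.357: `U₀ = exp iξA₀` with `A₀` small ON THE DOMAIN `Z` only). [cite: Balaban1989LargeFieldII, p.357, (1.7) p.358; Balaban1985BackgroundPropagators, (3.10) p.392] -/
theorem abs_deriv_deriv_wilsonAction4_leftChart_sub_flat_le_l2_local (U : GaugeField P j (SU N)) (Y : PBond P j → lieSU (Fin N)) (B : Set (PBond P j))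
    (hY : ∀ b ∉ B, Y b = 0) {δ : ℝ} (hδ0 : 0 ≤ δ)
    (hδ : ∀ p : Plaq P j, ((⟨p.src, p.μ⟩ : PBond P j) ∈ B ∨ (⟨p.src.shift p.μ, p.ν⟩ : PBond P j) ∈ B ∨ (⟨p.src.shift p.ν, p.μ⟩ : PBond P j) ∈ B ∨ (⟨p.src, p.ν⟩ : PBond P j) ∈ B) →
      ‖(U ⟨p.src, p.μ⟩ : Matrix (Fin N) (Fin N) ℂ) - 1‖ ≤ δ ∧ ‖(U ⟨p.src.shift p.μ, p.ν⟩ : Matrix (Fin N) (Fin N) ℂ) - 1‖ ≤ δ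
        ∧ ‖(U ⟨p.src.shift p.ν, p.μ⟩ : Matrix (Fin N) (Fin N) ℂ) - 1‖ ≤ δ ∧ ‖(U ⟨p.src, p.ν⟩ : Matrix (Fin N) (Fin N) ℂ) - 1‖ ≤ δ) :
    |deriv (deriv fun t : ℝ => wilsonAction4 (fun b => expSU ((t • Y) b) * U b)) 0
        - deriv (deriv fun t : ℝ => wilsonAction4 (expChart (1 : GaugeField P j (SU N)) (t • Y))) 0|
      ≤ 64 * ((P.d : ℝ) - 1) * δ * ∑ b : PBond P j, ‖(Y b : Matrix (Fin N) (Fin N) ℂ)‖ ^ 2 := by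
  classical
  -- per-plaquette budget: `δ` on the plaquettes meeting `B`, `2` elsewhere (every unitary is within `2` of `1`)
  let bud : Plaq P j → ℝ := fun p =>
    if ((⟨p.src, p.μ⟩ : PBond P j) ∈ B ∨ (⟨p.src.shift p.μ, p.ν⟩ : PBond P j) ∈ B ∨ (⟨p.src.shift p.ν, p.μ⟩ : PBond P j) ∈ B ∨ (⟨p.src, p.ν⟩ : PBond P j) ∈ B) then δ else 2
  have htwo : ∀ b : PBond P j, ‖(U b : Matrix (Fin N) (Fin N) ℂ) - 1‖ ≤ 2 := fun b => by
    have hu : (U b : Matrix (Fin N) (Fin N) ℂ) ∈ unitary (Matrix (Fin N) (Fin N) ℂ) := (U b).2.1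
    calc ‖(U b : Matrix (Fin N) (Fin N) ℂ) - 1‖ ≤ ‖(U b : Matrix (Fin N) (Fin N) ℂ)‖ + ‖(1 : Matrix (Fin N) (Fin N) ℂ)‖ := norm_sub_le _ _
      _ ≤ 1 + 1 := add_le_add (CStarRing.norm_of_mem_unitary hu).le (by rw [CStarRing.norm_of_mem_unitary (unitary (Matrix (Fin N) (Fin N) ℂ)).one_mem])
      _ = 2 := by norm_num
  have hbud : ∀ p : Plaq P j, ‖(U ⟨p.src, p.μ⟩ : Matrix (Fin N) (Fin N) ℂ) - 1‖ ≤ bud p ∧ ‖(U ⟨p.src.shift p.μ, p.ν⟩ : Matrix (Fin N) (Fin N) ℂ) - 1‖ ≤ bud p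
      ∧ ‖(U ⟨p.src.shift p.ν, p.μ⟩ : Matrix (Fin N) (Fin N) ℂ) - 1‖ ≤ bud p ∧ ‖(U ⟨p.src, p.ν⟩ : Matrix (Fin N) (Fin N) ℂ) - 1‖ ≤ bud p := by
    intro p
    by_cases h : ((⟨p.src, p.μ⟩ : PBond P j) ∈ B ∨ (⟨p.src.shift p.μ, p.ν⟩ : PBond P j) ∈ B ∨ (⟨p.src.shift p.ν, p.μ⟩ : PBond P j) ∈ B ∨ (⟨p.src, p.ν⟩ : PBond P j) ∈ B)
    · simp only [bud, if_pos h]; exact hδ p h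
    · simp only [bud, if_neg h]; exact ⟨htwo _, htwo _, htwo _, htwo _⟩
  have hmain := abs_deriv_deriv_wilsonAction4_leftChart_sub_flat_le_local U Y bud hbud
  -- the budget may be replaced by the constant `δ`: off the plaquettes meeting `B` the letters vanish
  have hrepl : ∀ p : Plaq P j, bud p * (‖(Y ⟨p.src, p.μ⟩ : Matrix (Fin N) (Fin N) ℂ)‖ + ‖(Y ⟨p.src.shift p.μ, p.ν⟩ : Matrix (Fin N) (Fin N) ℂ)‖
        + ‖(Y ⟨p.src.shift p.ν, p.μ⟩ : Matrix (Fin N) (Fin N) ℂ)‖ + ‖(Y ⟨p.src, p.ν⟩ : Matrix (Fin N) (Fin N) ℂ)‖) ^ 2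
      = δ * (‖(Y ⟨p.src, p.μ⟩ : Matrix (Fin N) (Fin N) ℂ)‖ + ‖(Y ⟨p.src.shift p.μ, p.ν⟩ : Matrix (Fin N) (Fin N) ℂ)‖
        + ‖(Y ⟨p.src.shift p.ν, p.μ⟩ : Matrix (Fin N) (Fin N) ℂ)‖ + ‖(Y ⟨p.src, p.ν⟩ : Matrix (Fin N) (Fin N) ℂ)‖) ^ 2 := by
    intro p
    by_cases h : ((⟨p.src, p.μ⟩ : PBond P j) ∈ B ∨ (⟨p.src.shift p.μ, p.ν⟩ : PBond P j) ∈ B ∨ (⟨p.src.shift p.ν, p.μ⟩ : PBond P j) ∈ B ∨ (⟨p.src, p.ν⟩ : PBond P j) ∈ B)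
    · simp only [bud, if_pos h]
    · simp only [not_or] at h
      obtain ⟨h1, h2, h3, h4⟩ := h
      rw [hY _ h1, hY _ h2, hY _ h3, hY _ h4]
      simp
  simp only [hrepl] at hmain
  calc |deriv (deriv fun t : ℝ => wilsonAction4 (fun b => expSU ((t • Y) b) * U b)) 0
          - deriv (deriv fun t : ℝ => wilsonAction4 (expChart (1 : GaugeField P j (SU N)) (t • Y))) 0|
      ≤ 8 * ∑ p : Plaq P j, δ * (‖(Y ⟨p.src, p.μ⟩ : Matrix (Fin N) (Fin N) ℂ)‖ + ‖(Y ⟨p.src.shift p.μ, p.ν⟩ : Matrix (Fin N) (Fin N) ℂ)‖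
          + ‖(Y ⟨p.src.shift p.ν, p.μ⟩ : Matrix (Fin N) (Fin N) ℂ)‖ + ‖(Y ⟨p.src, p.ν⟩ : Matrix (Fin N) (Fin N) ℂ)‖) ^ 2 := hmain
    _ = 8 * δ * ∑ p : Plaq P j, (‖(Y ⟨p.src, p.μ⟩ : Matrix (Fin N) (Fin N) ℂ)‖ + ‖(Y ⟨p.src.shift p.μ, p.ν⟩ : Matrix (Fin N) (Fin N) ℂ)‖
          + ‖(Y ⟨p.src.shift p.ν, p.μ⟩ : Matrix (Fin N) (Fin N) ℂ)‖ + ‖(Y ⟨p.src, p.ν⟩ : Matrix (Fin N) (Fin N) ℂ)‖) ^ 2 := by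
        rw [← Finset.mul_sum]; ring
    _ ≤ 8 * δ * (8 * ((P.d : ℝ) - 1) * ∑ b : PBond P j, ‖(Y b : Matrix (Fin N) (Fin N) ℂ)‖ ^ 2) :=
        mul_le_mul_of_nonneg_left (sum_plaq_boundary_sq_le fun b => ‖(Y b : Matrix (Fin N) (Fin N) ℂ)‖) (by positivity)
    _ = 64 * ((P.d : ℝ) - 1) * δ * ∑ b : PBond P j, ‖(Y b : Matrix (Fin N) (Fin N) ℂ)‖ ^ 2 := by ring

/-- **LETTER (b) IN `ℓ²(bonds)` CURRENCY, LEFT CHART, GLOBAL**: if every bond variable is within `δ` of `1`, `|Q^L_U(Y) − Q_1(Y)| ≤ 64(d−1)δ·Σ_b‖Y_b‖²`.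
[cite: Balaban1989LargeFieldII, p.357, (1.7) p.358; Balaban1985BackgroundPropagators, (3.1) p.390, (3.10) p.392] -/
theorem abs_deriv_deriv_wilsonAction4_leftChart_sub_flat_le_l2 (U : GaugeField P j (SU N)) (Y : PBond P j → lieSU (Fin N)) {δ : ℝ}
    (hδ : ∀ b : PBond P j, ‖(U b : Matrix (Fin N) (Fin N) ℂ) - 1‖ ≤ δ) :
    |deriv (deriv fun t : ℝ => wilsonAction4 (fun b => expSU ((t • Y) b) * U b)) 0
        - deriv (deriv fun t : ℝ => wilsonAction4 (expChart (1 : GaugeField P j (SU N)) (t • Y))) 0|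
      ≤ 64 * ((P.d : ℝ) - 1) * δ * ∑ b : PBond P j, ‖(Y b : Matrix (Fin N) (Fin N) ℂ)‖ ^ 2 := by
  obtain ⟨b₀⟩ : Nonempty (PBond P j) := ⟨⟨default, ⟨0, P.hd⟩⟩⟩
  exact abs_deriv_deriv_wilsonAction4_leftChart_sub_flat_le_l2_local U Y Set.univ (fun b hb => (hb (Set.mem_univ b)).elim)
    ((norm_nonneg _).trans (hδ b₀)) fun p _ => ⟨hδ _, hδ _, hδ _, hδ _⟩

end L2Letters

end Literature.MathematicalPhysics.QuantumFieldTheory.Balaban1983to89.Node00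

end
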